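/-
Copyright (c) 2026 the pub-hodgecm-mathlib formalisation cell (harness21).  Prover seat hodgecm-mathlib-LH4-p15 (g0), req620 Track A «(D-RAM) FOUR-FRAME» squad
(STAGE-1b, row (2) of the piece `f_{T₊}`, the (β₂) road (R-36) «PURE-CELL LEDGER»: heir LEAD F0P3a-plan (g21) T20-18∕T20-19; β₂ sub-dealer LH4-p04 (g8) β₂-BOARD v1.1
rows (L-S1)∕(L-S2) «PURITY» (holder LH4-p15); LH4-p09 (g9) 14:43:32Z caveat «exact-F flips unpopulate at a ≥ d», here in its positive form), 2026-09-04.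
-/
import Summits.HodgeConjecture.HodgeConjecture.Theorems.F0P3cDyRamConeCellFaceAxis   -- ★ p861154 (this seat): `image_mul_valueSetMod_smul_xPlus`, `valueSetMod_smul_xPlus_eq_of_exists_norm`; brings ★ `…ConeWeightHalfSplit` (`glueUnit_mul_left`), ★ DEFS `glueUnit ∕ IsGlueNorm ∕ dualGen`
import HarnessLib

/-!
# Crux `H413`, line LH4 «(D-RAM) FOUR-FRAME» — STAGE-1b, row (2), the (β₂) road (R-36): «A FLIP BETWEEN TWO POPULATED MEMBERS IS A NORM FLIP» — if `Λ = x₀·𝒪_j` and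
# `z·Λ` BOTH have glue units in the norm class (both fibres populated at∕above the glue conductor), the multiplier `ξ′ = z·Θz` of the flip is itself a glue norm, so the flip
# PRESERVES every label class: above the conductor no admissible flip distinguishes populated members of a cell

Cell `hodgecm-mathlib` (D-0151), FLOOR 0, crux item H413 = `stmt-HodgeConjecture-24833`, route of record `HCCMUnconditional`; squad F0∕P3c∕LH4; lane
`--supports stmt-HodgeConjecture-24833 --as helper` (count-neutral; pays NO tier-0 row).  THEOREMS ONLY (no `def`, no instance, no notation, no `sorry`, default heartbeats);
★-only imports; states NO law; (β₂) stays a HYPOTHESIS.  DATUM-FREE (§1–§3: fields `M` ∕ `E`, ring maps `ρ Θ σ jE`; §4: `σ` isometric; no residue field, no `|2|`, no completeness).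

WHY (this seat 15:37:37Z REDUCTION on ★ p861372 ∕ ★ p861353; LH4-p09 (g9) 14:43:32Z).  By ★ p861372 the label of the vertex over `g·Λ₀` is a function `ψ(ν)` of `ν = N_Θ(g)`
alone, and PURE(cell) ⟺ `ψ` is constant on the `ν` realised by POPULATED members.  The admissible flips (`ν = ξ′ ∈ F`) move the label by `ω(ξ)` (★ p861154 ∕ ★ p861368); ★
`F0P3cDyRamConeWeightHalfSplit.glueUnit_mul_left` moves the GLUE UNIT by `r ↦ r∕ξ′`.  At∕above the glue conductor a fibre is populated iff its glue unit is a norm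
(★ T1), so:
* §1 `isGlueNorm_of_isGlueNorm_div` — two glue norms `r`, `r∕ξ′` differ by a glue norm: `IsGlueNorm ρ Θ ξ′` (`ξ′ = (e∕e′)·Θ(e∕e′)`).
* §2 `isGlueNorm_flip_of_populated` — if the glue units of `x₀` and of `z·x₀` are BOTH glue norms, the flip multiplier `ξ′ = z·Θz` is a glue norm (★ `glueUnit_mul_left` ∘ §1).
* §3 `exists_norm_of_isGlueNorm_map` — a glue norm of the form `jE ξ` is `jE` of a norm of `E`: `∃ c, c·σc = ξ` (`hjfix`, `hΘj`).
* §4 HEAD `valueSet_class_iff_of_populated_flip` — with the value-set dictionary of ★ p861154 §4 (`S′ = (ξ·) '' S`, the letters of `z • Λ` vs `Λ`): if both members are populated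
  then for EVERY unit class `e`, `S = VS_m(e • X₊) ↔ S′ = VS_m(e • X₊)` — the flip preserves the label (★ p861154 §1 algebra, `ξ ∈ N`).  Hence on the rows `a ≥ d` of the board
  (`D`, `S₁`, the tower, `K₀`) purity∕balance is decided by the NON-`F` norm classes `ν` only; the ω-flip road balances nothing there.
HONEST LABEL.  Count-neutral algebra; nothing printed is asserted; no census law is stated; which `ν` are realised on which cell is NOT claimed; `HC_CM` is proved only modulo the
7 printed citations (2 remaining named inputs: hLiu418 = `stmt-HodgeConjecture-24832`, h413 = `stmt-HodgeConjecture-24833`) until rung 0 closes.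
## References
* [Jacobowitz1962] R. Jacobowitz, *Hermitian forms over local fields*, Amer. J. Math. 84 (1962): §4 (dual lattices, modular components, norm-residue gluing).
* [Serre1979] J.-P. Serre, *Local Fields*, GTM 67 (1979): Ch. V §3 Prop. 5, Cor. 3 pp. 85–87 (norm classes of units of a ramified quadratic extension).
* [Rogawski1990] J. D. Rogawski, *Automorphic Representations of Unitary Groups in Three Variables*, Ann. of Math. Stud. 123 (1990): §4.9 Prop. 4.9.1 (b) p. 55 (the labelled census of `f_{T₊}`).
* [Kottwitz1986BaseChangeUnits] R. E. Kottwitz, *Base change for unit elements of Hecke algebras*, Compositio Math. 60 (1986): §1 pp. 240–241.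
-/

set_option autoImplicit false

noncomputable section

namespace Summit.HodgeConjecture.HodgeConjecture.Cruxes.H413.F0P3cDyRamPopulatedFlipNormClass

open scoped Valued WithZero Pointwise
open WithZero
open Summit.HodgeConjecture.HodgeConjecture.Cruxes.H413.F0P3cDyRamFourFramePieces
open Summit.HodgeConjecture.HodgeConjecture.Cruxes.H413.F0P3cDyRamToricCensusDefs
open Summit.HodgeConjecture.HodgeConjecture.Cruxes.H413.F0P3cDyRamConeWeightHalfSplit (glueUnit_mul_left)
open Summit.HodgeConjecture.HodgeConjecture.Cruxes.H413.F0P3cDyRamConeCellFaceAxis (image_mul_valueSetMod_smul_xPlus valueSetMod_smul_xPlus_eq_of_exists_norm)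

/-! ## §1 Two glue norms differ by a glue norm -/

section OneField

variable {M : Type*} [Field M] [Valued M ℤᵐ⁰] {ρ Θ : M →+* M} {α : M}

/-- **TWO GLUE NORMS DIFFER BY A GLUE NORM**: if `r = e·Θe` and `r∕ξ′ = e′·Θe′` with `e, e′` `ρ`-fixed units (★ DEFS `IsGlueNorm`), then `ξ′ = (e∕e′)·Θ(e∕e′)` is a glue norm.
[cite: Serre1979, Ch. V §3 Cor. 3] [cite: Jacobowitz1962, §4] -/
theorem isGlueNorm_of_isGlueNorm_div {r ξ' : M} (hr : IsGlueNorm ρ Θ r) (hr' : IsGlueNorm ρ Θ (r / ξ')) : IsGlueNorm ρ Θ ξ' := by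
  obtain ⟨e, hρe, he1, her⟩ := hr
  obtain ⟨e', hρe', he'1, her'⟩ := hr'
  have he'0 : e' ≠ 0 := fun h0 => by rw [h0, map_zero] at he'1; exact zero_ne_one he'1
  have hΘe'0 : Θ e' ≠ 0 := (map_ne_zero Θ).2 he'0
  have hq0 : r / ξ' ≠ 0 := by rw [← her']; exact mul_ne_zero he'0 hΘe'0
  have hr0 : r ≠ 0 := fun h0 => by rw [h0, zero_div] at hq0; exact hq0 rfl
  have hξ0 : ξ' ≠ 0 := fun h0 => by rw [h0, div_zero] at hq0; exact hq0 rfl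
  refine ⟨e / e', by rw [map_div₀, hρe, hρe'], by rw [map_div₀, he1, he'1, div_one], ?_⟩
  have hξ : ξ' = r / (r / ξ') := by field_simp
  rw [hξ, ← her', ← her, map_div₀]
  field_simp

/-! ## §2 The flip between two populated members is a norm flip -/

/-- **A FLIP BETWEEN TWO POPULATED MEMBERS IS A NORM FLIP.**  For a flip `z` (`z·Θz = ξ′`, `ρξ′ = ξ′`, `ξ′ ≠ 0`, `Θ` an involution) and a generator `x₀` with non-zero dual generator:
if the glue units of `x₀` AND of `z·x₀` (★ DEFS `glueUnit`, same `c, h, ϖE, c_U, b`) are both glue norms — both fibres POPULATED at∕above the glue conductor — then `ξ′` is a glue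
norm (★ `glueUnit_mul_left`: the second glue unit is the first divided by `ξ′`). [cite: Jacobowitz1962, §4] [cite: Serre1979, Ch. V §3 Cor. 3] -/
theorem isGlueNorm_flip_of_populated (hΘΘ : ∀ x, Θ (Θ x) = x) {z ξ' : M} (hzξ : z * Θ z = ξ') (hρξ : ρ ξ' = ξ') (hξ0 : ξ' ≠ 0)
    {c h x₀ : M} (hY0 : dualGen ρ Θ α c h x₀ ≠ 0) (ϖE cU : M) (b : ℕ)
    (hpop : IsGlueNorm ρ Θ (glueUnit ρ Θ α c h ϖE cU x₀ b)) (hpop' : IsGlueNorm ρ Θ (glueUnit ρ Θ α c h ϖE cU (z * x₀) b)) :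
    IsGlueNorm ρ Θ ξ' := by
  rw [glueUnit_mul_left (α := α) hΘΘ hzξ hρξ hξ0 hY0 ϖE cU b] at hpop'
  exact isGlueNorm_of_isGlueNorm_div hpop hpop'

end OneField

/-! ## §3 A glue norm coming from `E` is the image of a norm of `E` -/

section TwoFields

variable {E : Type} {M : Type*} [Field E] [Valued E ℤᵐ⁰] [Field M] [Valued M ℤᵐ⁰] {ρ Θ : M →+* M} {α : M} {σ : E →+* E}

omit [Valued E ℤᵐ⁰] in
/-- **`IsGlueNorm ρ Θ (jE ξ) ⇒ ξ ∈ N(Eˣ)`**: the `ρ`-fixed witness is `jE c` (`hjfix`), and `jE(c·σc) = jE c·Θ(jE c)` (`hΘj`). [cite: Serre1979, Ch. V §3 Cor. 3] -/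
theorem exists_norm_of_isGlueNorm_map (jE : E →+* M) (hΘj : ∀ x, Θ (jE x) = jE (σ x)) (hjfix : ∀ w, ρ w = w ↔ ∃ c, jE c = w)
    {ξ : E} (h : IsGlueNorm ρ Θ (jE ξ)) : ∃ c : E, c * σ c = ξ := by
  obtain ⟨e, hρe, -, he⟩ := h
  obtain ⟨c, rfl⟩ := (hjfix e).1 hρe
  refine ⟨c, jE.injective ?_⟩
  rw [map_mul, ← hΘj]
  exact he

/-! ## §4 HEAD — a flip between two populated members preserves every label class -/

/-- **A FLIP BETWEEN TWO POPULATED MEMBERS PRESERVES EVERY LABEL CLASS.**  Line model `(M, jE, ρ, Θ)` over the plane field `E` (`σ` isometric, `Θ ∘ jE = jE ∘ σ`, `Fix ρ = jE(E)`,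
`Θ` an involution); a flip `z` with `z·Θz = jE ξ`, `ξ` a unit of `E`; a generator `x₀` with non-zero dual generator whose glue unit AND that of `z·x₀` are glue norms (both fibres
populated); and the value-set dictionary of ★ p861154 §4 between the letters of the two vertices, `S′ = (ξ·) '' S`.  THEN for every unit class `e`:
`S = valueSetMod σ ϖ m (e • X₊) ↔ S′ = valueSetMod σ ϖ m (e • X₊)` — `ξ` is a norm (§2–§3), and norm multipliers preserve the class (★ p861154 §1).  So at∕above the glue conductor
the admissible flips never distinguish populated members: purity∕balance there is a question about the non-`F` norm classes only.
[cite: Serre1979, Ch. V §3 Cor. 3] [cite: Rogawski1990, §4.9 Prop. 4.9.1 (b) p. 55] [cite: Kottwitz1986BaseChangeUnits, §1 pp. 240–241] -/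
theorem valueSet_class_iff_of_populated_flip (hvσ : ∀ a, Valued.v (σ a) = Valued.v a) (jE : E →+* M) (hΘj : ∀ x, Θ (jE x) = jE (σ x))
    (hjfix : ∀ w, ρ w = w ↔ ∃ c, jE c = w) (hΘΘ : ∀ x, Θ (Θ x) = x)
    {z : M} {ξ : E} (hzξ : z * Θ z = jE ξ) (hξ1 : Valued.v ξ = 1)
    {c h x₀ : M} (hY0 : dualGen ρ Θ α c h x₀ ≠ 0) (ϖE cU : M) (b : ℕ)
    (hpop : IsGlueNorm ρ Θ (glueUnit ρ Θ α c h ϖE cU x₀ b)) (hpop' : IsGlueNorm ρ Θ (glueUnit ρ Θ α c h ϖE cU (z * x₀) b))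
    (ϖ : E) (d m : ℕ) {S S' : Set E} (hS' : S' = (fun t => ξ * t) '' S) {e : E} (he1 : Valued.v e = 1) :
    S = valueSetMod σ ϖ m (e • xPlus σ ϖ d) ↔ S' = valueSetMod σ ϖ m (e • xPlus σ ϖ d) := by
  have hξ0 : ξ ≠ 0 := fun h0 => by rw [h0, map_zero] at hξ1; exact zero_ne_one hξ1
  have hρξ : ρ (jE ξ) = jE ξ := (hjfix _).2 ⟨ξ, rfl⟩
  have hξ0' : jE ξ ≠ 0 := (map_ne_zero jE).2 hξ0
  -- the multiplier is a norm
  obtain ⟨w, hw⟩ := exists_norm_of_isGlueNorm_map jE hΘj hjfix (isGlueNorm_flip_of_populated (α := α) hΘΘ hzξ hρξ hξ0' hY0 ϖE cU b hpop hpop')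
  have hξe1 : Valued.v (ξ * e) = 1 := by rw [map_mul, hξ1, he1, one_mul]
  have hξie1 : Valued.v (ξ⁻¹ * e) = 1 := by rw [map_mul, map_inv₀, hξ1, inv_one, he1, one_mul]
  have he0 : e ≠ 0 := fun h0 => by rw [h0, map_zero] at he1; exact zero_ne_one he1
  have hfwd : valueSetMod σ ϖ m ((ξ * e) • xPlus σ ϖ d) = valueSetMod σ ϖ m (e • xPlus σ ϖ d) :=
    valueSetMod_smul_xPlus_eq_of_exists_norm hvσ ϖ d m hξe1 he1 ⟨w, by rw [hw, mul_assoc, mul_inv_cancel₀ he0, mul_one]⟩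
  have hbwd : valueSetMod σ ϖ m ((ξ⁻¹ * e) • xPlus σ ϖ d) = valueSetMod σ ϖ m (e • xPlus σ ϖ d) := by
    have hσw0 : σ w ≠ 0 := fun h0 => by rw [h0, mul_zero] at hw; exact hξ0 hw.symm
    have hw0 : w ≠ 0 := fun h0 => by rw [h0, zero_mul] at hw; exact hξ0 hw.symm
    refine valueSetMod_smul_xPlus_eq_of_exists_norm hvσ ϖ d m hξie1 he1 ⟨w⁻¹, ?_⟩
    rw [map_inv₀, ← mul_inv, hw, mul_assoc, mul_inv_cancel₀ he0, mul_one]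
  -- the inverse dictionary
  have hS : S = (fun t => ξ⁻¹ * t) '' S' := by
    rw [hS', Set.image_image]
    simp only [inv_mul_cancel_left₀ hξ0, Set.image_id']
  constructor
  · intro hSe
    rw [hS', hSe, image_mul_valueSetMod_smul_xPlus σ ϖ d m e hξ1, hfwd]
  · intro hS'e
    rw [hS, hS'e, image_mul_valueSetMod_smul_xPlus σ ϖ d m e (by rw [map_inv₀, hξ1, inv_one]), hbwd]

end TwoFields

end Summit.HodgeConjecture.HodgeConjecture.Cruxes.H413.F0P3cDyRamPopulatedFlipNormClass

end
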